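import Summits.Ventures.PercRepro.GenQSolidDemandFree

/-!
# PercRepro — collinear triples and triples of rank `3` in a set with lines `≤ 3` points (night-4, gen 4)

For the row (R5b) of the type-`5` LP of record (sheet §55) the planes of a solid are paid for by their triples of
rank `3`: a `6`-point set with lines `≤ 3` has at most `4` collinear triples (each point lies on `≤ 2` of them, and two
collinear triples through a point share only that point), a `5`-point set at most `3`.

* `card_le_three_of_eRk_le_two'`: a set of rank `≤ 2` has `≤ 3` points (lines `≤ 3`);
* `collinear_triples_through_disjoint`, `card_collinear_triples_through_le`: the collinear triples through `x`, minus
  `x`, are pairwise disjoint `2`-subsets, so `≤ ⌊(|X| − 1)/2⌋` of them;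
* `card_collinear_triples_mul_three_le`: `3·#{collinear triples} ≤ |X|·⌊(|X| − 1)/2⌋`;
* `card_rank_three_triples_ge`: a `6`-point (`5`-point) set has `≥ 16` (`≥ 7`) triples of rank `3`.

Imports `GenQSolidDemandFree`.
-/
namespace PercRepro.Night4

open Finset ThmH SixFour GenQ PerFlat Star

variable {α : Type*} [DecidableEq α] {M : Matroid α} [M.Finite]

/-! ## Collinear triples -/

omit [DecidableEq α] in
/-- A set of rank `≤ 2` of a matroid with lines `≤ 3` points has `≤ 3` points: it lies in the line `cl` of two of its
points (a set of `≥ 2` points of a simple matroid has rank exactly `2` when its rank is `≤ 2`). -/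
theorem card_le_three_of_eRk_le_two' (hs : Simple M) (hline : ∀ L ∈ flatsQ M 2, L.card ≤ 3) {X : Finset α}
    (hX : X ⊆ gr M) (hr : M.eRk (X : Set α) ≤ 2) : X.card ≤ 3 := by
  by_cases h2 : X.card ≤ 1
  · omega
  have h2' : 1 < X.card := by omega
  obtain ⟨u, hu, v, hv, huv⟩ := Finset.one_lt_card.1 h2'
  have hr2 : M.eRk (X : Set α) = 2 := le_antisymm hr (two_le_eRk_of_two_mem hs hX hu hv huv)
  have hXE : (X : Set α) ⊆ M.E := by
    rw [← coe_gr M]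
    exact Finset.coe_subset.2 hX
  have hflat : clF M X ∈ flatsQ M 2 := by
    rw [mem_flatsQ]
    refine ⟨?_, ?_, ?_⟩
    · intro x hx
      rw [← Finset.mem_coe, coe_clF] at hx
      have := M.closure_subset_ground _ hx
      rw [← coe_gr M] at this
      exact Finset.mem_coe.1 this
    · rw [coe_clF]
      exact M.isFlat_closure _
    · rw [coe_clF, M.eRk_closure_eq, hr2]
      rfl
  have hsub : X ⊆ clF M X := by
    intro x hx
    rw [← Finset.mem_coe, coe_clF]
    exact M.subset_closure _ hXE (Finset.mem_coe.2 hx)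
  exact (Finset.card_le_card hsub).trans (hline _ hflat)

/-- Two collinear triples through a point `x` of `X` share only `x` (lines `≤ 3`): the triples through `x` minus `x`
are pairwise disjoint `2`-subsets of `X.erase x`. -/
theorem collinear_triples_through_disjoint (hs : Simple M) (hline : ∀ L ∈ flatsQ M 2, L.card ≤ 3) {X : Finset α}
    (hX : X ⊆ gr M) {x : α} {T T' : Finset α} (hT : T ∈ X.powersetCard 3) (hT' : T' ∈ X.powersetCard 3)
    (hrT : M.eRk (T : Set α) ≤ 2) (hrT' : M.eRk (T' : Set α) ≤ 2) (hxT : x ∈ T) (hxT' : x ∈ T') (hne : T ≠ T') :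
    Disjoint (T.erase x) (T'.erase x) := by
  rw [Finset.mem_powersetCard] at hT hT'
  rw [Finset.disjoint_left]
  intro y hyT hyT'
  have hyT1 := Finset.mem_erase.1 hyT
  have hyT'1 := Finset.mem_erase.1 hyT'
  -- `T ∪ T'` has rank `≤ 2` (both contain `{x, y}` of rank `2`) and `≥ 4` points
  have hxy : ({x, y} : Finset α) ⊆ T := by
    intro z hz
    simp only [Finset.mem_insert, Finset.mem_singleton] at hz
    rcases hz with rfl | rfl
    · exact hxT
    · exact hyT1.2
  have hxy' : ({x, y} : Finset α) ⊆ T' := by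
    intro z hz
    simp only [Finset.mem_insert, Finset.mem_singleton] at hz
    rcases hz with rfl | rfl
    · exact hxT'
    · exact hyT'1.2
  have hr2 : M.eRk (({x, y} : Finset α) : Set α) = 2 := by
    apply le_antisymm
    · exact (M.eRk_mono (Finset.coe_subset.2 hxy)).trans hrT
    · exact two_le_eRk_of_two_mem hs ((hxy.trans hT.1).trans hX) (by simp) (by simp) (Ne.symm hyT1.1)
  have hclT : M.closure (({x, y} : Finset α) : Set α) = M.closure (T : Set α) :=
    (M.isRkFinite_of_finite (Finset.finite_toSet _)).closure_eq_closure_of_subset_of_eRk_ge_eRk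
      (Finset.coe_subset.2 hxy) (by rw [hr2]; exact hrT)
  have hclT' : M.closure (({x, y} : Finset α) : Set α) = M.closure (T' : Set α) :=
    (M.isRkFinite_of_finite (Finset.finite_toSet _)).closure_eq_closure_of_subset_of_eRk_ge_eRk
      (Finset.coe_subset.2 hxy') (by rw [hr2]; exact hrT')
  have hU : (T ∪ T' : Finset α) ⊆ clF M T := by
    intro z hz
    rw [← Finset.mem_coe, coe_clF]
    have hzE : z ∈ M.E := by
      rw [← coe_gr M]
      rcases Finset.mem_union.1 hz with h | h
      · exact Finset.mem_coe.2 (hX (hT.1 h))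
      · exact Finset.mem_coe.2 (hX (hT'.1 h))
    rcases Finset.mem_union.1 hz with h | h
    · exact M.mem_closure_of_mem' (Finset.mem_coe.2 h) hzE
    · rw [← hclT, hclT']
      exact M.mem_closure_of_mem' (Finset.mem_coe.2 h) hzE
  have hrcl : M.eRk ((clF M T : Finset α) : Set α) ≤ 2 := by
    rw [coe_clF, M.eRk_closure_eq]
    exact hrT
  have hclg : clF M T ⊆ gr M := by
    intro z hz
    rw [← Finset.mem_coe, coe_clF] at hz
    have := M.closure_subset_ground _ hz
    rw [← coe_gr M] at this
    exact Finset.mem_coe.1 this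
  have h3 := card_le_three_of_eRk_le_two' hs hline hclg hrcl
  have hU3 := (Finset.card_le_card hU).trans h3
  -- but `T ∪ T'` has `≥ 4` points since `T ≠ T'` are distinct `3`-sets
  have h4 : 4 ≤ (T ∪ T').card := by
    have hne' : ¬ T' ⊆ T := fun h => hne (Finset.eq_of_subset_of_card_le h (by omega)).symm
    obtain ⟨w, hwT', hwT⟩ := Finset.not_subset.1 hne'
    have : insert w T ⊆ T ∪ T' := by
      intro z hz
      rcases Finset.mem_insert.1 hz with rfl | h
      · exact Finset.mem_union_right _ hwT'
      · exact Finset.mem_union_left _ h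
    have := Finset.card_le_card this
    rw [Finset.card_insert_of_notMem hwT, hT.2] at this
    omega
  omega

/-- The collinear triples through `x`, with `x` removed, are pairwise disjoint `2`-subsets of `X.erase x`: at most
`⌊(|X| − 1)/2⌋` of them. -/
theorem card_collinear_triples_through_le (hs : Simple M) (hline : ∀ L ∈ flatsQ M 2, L.card ≤ 3) {X : Finset α}
    (hX : X ⊆ gr M) (x : α) :
    ((X.powersetCard 3).filter (fun T : Finset α => M.eRk (T : Set α) ≤ 2 ∧ x ∈ T)).card ≤ (X.card - 1) / 2 := by
  set 𝒯 := (X.powersetCard 3).filter (fun T : Finset α => M.eRk (T : Set α) ≤ 2 ∧ x ∈ T) with h𝒯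
  by_cases hxX : x ∈ X
  · -- the family `T ↦ T.erase x` is pairwise disjoint in `X.erase x`
    have hinj : Set.InjOn (fun T : Finset α => T.erase x) (𝒯 : Set (Finset α)) := by
      intro T hT T' hT' h
      have hT1 := (Finset.mem_filter.1 (Finset.mem_coe.1 hT)).2.2
      have hT'1 := (Finset.mem_filter.1 (Finset.mem_coe.1 hT')).2.2
      rw [← Finset.insert_erase hT1, ← Finset.insert_erase hT'1]
      simp only at h
      rw [h]
    have hdisj : (𝒯.image (fun T : Finset α => T.erase x) : Set (Finset α)).PairwiseDisjoint id := by
      intro A hA B hB hAB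
      rw [Finset.coe_image] at hA hB
      obtain ⟨T, hT, rfl⟩ := hA
      obtain ⟨T', hT', rfl⟩ := hB
      have hT1 := Finset.mem_filter.1 (Finset.mem_coe.1 hT)
      have hT'1 := Finset.mem_filter.1 (Finset.mem_coe.1 hT')
      have hne : T ≠ T' := fun h => hAB (by rw [h])
      exact collinear_triples_through_disjoint hs hline hX hT1.1 hT'1.1 hT1.2.1 hT'1.2.1 hT1.2.2 hT'1.2.2 hne
    have hsub : (𝒯.image (fun T : Finset α => T.erase x)).biUnion id ⊆ X.erase x := by
      intro y hy
      rw [Finset.mem_biUnion] at hy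
      obtain ⟨A, hA, hyA⟩ := hy
      rw [Finset.mem_image] at hA
      obtain ⟨T, hT, rfl⟩ := hA
      have hT1 := Finset.mem_filter.1 hT
      have hTX := (Finset.mem_powersetCard.1 hT1.1).1
      simp only [id] at hyA
      rw [Finset.mem_erase] at hyA ⊢
      exact ⟨hyA.1, hTX hyA.2⟩
    have hcard : ((𝒯.image (fun T : Finset α => T.erase x)).biUnion id).card =
        ∑ A ∈ 𝒯.image (fun T : Finset α => T.erase x), A.card := by
      rw [Finset.card_biUnion (fun A hA B hB hAB => hdisj (Finset.mem_coe.2 hA) (Finset.mem_coe.2 hB) hAB)]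
      rfl
    have hsum : ∑ A ∈ 𝒯.image (fun T : Finset α => T.erase x), A.card =
        2 * (𝒯.image (fun T : Finset α => T.erase x)).card := by
      rw [Finset.card_eq_sum_ones, Finset.mul_sum]
      apply Finset.sum_congr rfl
      intro A hA
      rw [Finset.mem_image] at hA
      obtain ⟨T, hT, rfl⟩ := hA
      have hT1 := Finset.mem_filter.1 hT
      rw [Finset.card_erase_of_mem hT1.2.2, (Finset.mem_powersetCard.1 hT1.1).2]
      norm_num
    have himg : (𝒯.image (fun T : Finset α => T.erase x)).card = 𝒯.card := Finset.card_image_of_injOn hinj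
    have hle := Finset.card_le_card hsub
    rw [hcard, hsum, himg, Finset.card_erase_of_mem hxX] at hle
    omega
  · have : 𝒯 = ∅ := by
      rw [Finset.eq_empty_iff_forall_notMem]
      intro T hT
      have hT1 := Finset.mem_filter.1 hT
      exact hxX ((Finset.mem_powersetCard.1 hT1.1).1 hT1.2.2)
    rw [this, Finset.card_empty]
    exact Nat.zero_le _

/-- **`3·#{collinear triples of X} ≤ |X|·⌊(|X| − 1)/2⌋`** (double counting the incidences). -/
theorem card_collinear_triples_mul_three_le (hs : Simple M) (hline : ∀ L ∈ flatsQ M 2, L.card ≤ 3) {X : Finset α}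
    (hX : X ⊆ gr M) :
    3 * ((X.powersetCard 3).filter (fun T : Finset α => M.eRk (T : Set α) ≤ 2)).card ≤ X.card * ((X.card - 1) / 2) := by
  set 𝒯 := (X.powersetCard 3).filter (fun T : Finset α => M.eRk (T : Set α) ≤ 2) with h𝒯
  have h1 : 3 * 𝒯.card = ∑ T ∈ 𝒯, T.card := by
    rw [Finset.card_eq_sum_ones, Finset.mul_sum]
    apply Finset.sum_congr rfl
    intro T hT
    rw [(Finset.mem_powersetCard.1 (Finset.mem_filter.1 hT).1).2, mul_one]
  have h2 : ∑ T ∈ 𝒯, T.card = ∑ T ∈ 𝒯, (X.filter (fun x => x ∈ T)).card := by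
    apply Finset.sum_congr rfl
    intro T hT
    have hTX := (Finset.mem_powersetCard.1 (Finset.mem_filter.1 hT).1).1
    congr 1
    ext y
    rw [Finset.mem_filter]
    exact ⟨fun h => ⟨hTX h, h⟩, fun h => h.2⟩
  have h3 : ∑ T ∈ 𝒯, (X.filter (fun x => x ∈ T)).card = ∑ x ∈ X, (𝒯.filter (fun T : Finset α => x ∈ T)).card := by
    simp only [Finset.card_eq_sum_ones, Finset.sum_filter]
    rw [Finset.sum_comm]
  have h4 : ∀ x ∈ X, (𝒯.filter (fun T : Finset α => x ∈ T)).card ≤ (X.card - 1) / 2 := by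
    intro x _
    have := card_collinear_triples_through_le hs hline hX x
    rw [h𝒯, Finset.filter_filter]
    exact this
  calc 3 * 𝒯.card = ∑ x ∈ X, (𝒯.filter (fun T : Finset α => x ∈ T)).card := by rw [h1, h2, h3]
    _ ≤ ∑ _x ∈ X, (X.card - 1) / 2 := Finset.sum_le_sum h4
    _ = X.card * ((X.card - 1) / 2) := by rw [Finset.sum_const, smul_eq_mul]

/-! ## Triples of rank `3` -/

omit [M.Finite] in
/-- Every triple of `X ⊆ E` has rank `3` or rank `≤ 2`: `C(|X|, 3) ≤ #{rk = 3} + #{rk ≤ 2}`. -/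
theorem choose_three_le_rank_three_add_collinear (X : Finset α) :
    X.card.choose 3 ≤ ((X.powersetCard 3).filter (fun T : Finset α => M.eRk (T : Set α) = 3)).card +
      ((X.powersetCard 3).filter (fun T : Finset α => M.eRk (T : Set α) ≤ 2)).card := by
  rw [← Finset.card_powersetCard]
  rw [← Finset.card_union_of_disjoint (by
    rw [Finset.disjoint_filter]
    intro T _ h1 h2
    rw [h1] at h2
    exact absurd h2 (by decide))]
  apply Finset.card_le_card
  intro T hT
  rw [Finset.mem_union, Finset.mem_filter, Finset.mem_filter]
  have hr : M.eRk (T : Set α) ≤ 3 := by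
    have := M.eRk_le_encard (T : Set α)
    rw [Set.encard_coe_eq_coe_finsetCard, (Finset.mem_powersetCard.1 hT).2] at this
    exact this
  by_cases h3 : M.eRk (T : Set α) = 3
  · exact Or.inl ⟨hT, h3⟩
  · refine Or.inr ⟨hT, ?_⟩
    obtain ⟨r, hr'⟩ := exists_eRk_eq_nat (M := M) T
    rw [hr'] at hr h3 ⊢
    have hr3 : r ≤ 3 := by exact_mod_cast hr
    have hne : r ≠ 3 := fun h => h3 (by rw [h]; rfl)
    have : r ≤ 2 := by omega
    exact_mod_cast this

/-- **A `6`-point (`5`-point, `4`-point) set with lines `≤ 3` has `≥ 16` (`≥ 7`, `≥ 3`) triples of rank `3`.** -/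
theorem card_rank_three_triples_ge (hs : Simple M) (hline : ∀ L ∈ flatsQ M 2, L.card ≤ 3) {X : Finset α}
    (hX : X ⊆ gr M) :
    (X.card = 6 → 16 ≤ ((X.powersetCard 3).filter (fun T : Finset α => M.eRk (T : Set α) = 3)).card) ∧
      (X.card = 5 → 7 ≤ ((X.powersetCard 3).filter (fun T : Finset α => M.eRk (T : Set α) = 3)).card) ∧
      (X.card = 4 → 3 ≤ ((X.powersetCard 3).filter (fun T : Finset α => M.eRk (T : Set α) = 3)).card) := by
  have h1 := choose_three_le_rank_three_add_collinear (M := M) X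
  have h2 := card_collinear_triples_mul_three_le hs hline hX
  refine ⟨fun h6 => ?_, fun h5 => ?_, fun h4 => ?_⟩
  · rw [h6] at h1 h2
    have hc : Nat.choose 6 3 = 20 := by decide
    rw [hc] at h1
    norm_num at h2
    omega
  · rw [h5] at h1 h2
    have hc : Nat.choose 5 3 = 10 := by decide
    rw [hc] at h1
    norm_num at h2
    omega
  · rw [h4] at h1 h2
    have hc : Nat.choose 4 3 = 4 := by decide
    rw [hc] at h1
    norm_num at h2
    omega

/-- Two distinct collinear triples of a `5`-point set share exactly one point. -/
theorem collinear_triples_inter_eq_singleton (hs : Simple M) (hline : ∀ L ∈ flatsQ M 2, L.card ≤ 3) {Z : Finset α}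
    (hZ : Z ⊆ gr M) (h5 : Z.card = 5) {T T' : Finset α} (hT : T ∈ Z.powersetCard 3) (hT' : T' ∈ Z.powersetCard 3)
    (hrT : M.eRk (T : Set α) ≤ 2) (hrT' : M.eRk (T' : Set α) ≤ 2) (hne : T ≠ T') : ∃ c, T ∩ T' = {c} := by
  have hT1 := Finset.mem_powersetCard.1 hT
  have hT'1 := Finset.mem_powersetCard.1 hT'
  have hmeet : (T ∩ T').Nonempty := by
    by_contra hemp
    rw [Finset.not_nonempty_iff_eq_empty] at hemp
    have h1 : (T ∪ T').card = 6 := by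
      rw [Finset.card_union_of_disjoint (Finset.disjoint_iff_inter_eq_empty.2 hemp), hT1.2, hT'1.2]
    have := Finset.card_le_card (Finset.union_subset hT1.1 hT'1.1)
    omega
  obtain ⟨c, hc⟩ := hmeet
  have hcT := (Finset.mem_inter.1 hc).1
  have hcT' := (Finset.mem_inter.1 hc).2
  refine ⟨c, ?_⟩
  have hdisj := collinear_triples_through_disjoint hs hline hZ hT hT' hrT hrT' hcT hcT' hne
  ext x
  rw [Finset.mem_inter, Finset.mem_singleton]
  constructor
  · rintro ⟨hxT, hxT'⟩
    by_contra hxc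
    exact Finset.disjoint_left.1 hdisj (Finset.mem_erase.2 ⟨hxc, hxT⟩) (Finset.mem_erase.2 ⟨hxc, hxT'⟩)
  · rintro rfl; exact ⟨hcT, hcT'⟩

/-- **A `5`-point set has at most two collinear triples** (lines `≤ 3`): three would pairwise share one point, two of
them would cover the set, and the third would have `≤ 2` points. -/
theorem card_collinear_le_two (hs : Simple M) (hline : ∀ L ∈ flatsQ M 2, L.card ≤ 3) {Z : Finset α}
    (hZ : Z ⊆ gr M) (h5 : Z.card = 5) :
    ((Z.powersetCard 3).filter (fun T : Finset α => M.eRk (T : Set α) ≤ 2)).card ≤ 2 := by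
  set 𝒯 := (Z.powersetCard 3).filter (fun T : Finset α => M.eRk (T : Set α) ≤ 2) with h𝒯
  have hmem : ∀ T, T ∈ 𝒯 ↔ T ∈ Z.powersetCard 3 ∧ M.eRk (T : Set α) ≤ 2 := fun T => Finset.mem_filter
  by_contra h
  have h3 : 2 < 𝒯.card := by omega
  obtain ⟨T₁, hT₁, T₂, hT₂, T₃, hT₃, hne, h13, h23⟩ := Finset.two_lt_card.1 h3
  have hT1 := (hmem T₁).1 hT₁
  have hT2 := (hmem T₂).1 hT₂
  have hT3 := (hmem T₃).1 hT₃
  obtain ⟨c, hc⟩ := collinear_triples_inter_eq_singleton hs hline hZ h5 hT1.1 hT2.1 hT1.2 hT2.2 hne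
  have hu : (T₁ ∪ T₂).card = 5 := by
    have := Finset.card_union_add_card_inter T₁ T₂
    rw [hc, Finset.card_singleton, (Finset.mem_powersetCard.1 hT1.1).2, (Finset.mem_powersetCard.1 hT2.1).2] at this
    omega
  have hTZ : T₁ ∪ T₂ = Z := Finset.eq_of_subset_of_card_le
    (Finset.union_subset (Finset.mem_powersetCard.1 hT1.1).1 (Finset.mem_powersetCard.1 hT2.1).1) (by omega)
  obtain ⟨c₁, hc₁⟩ := collinear_triples_inter_eq_singleton hs hline hZ h5 hT3.1 hT1.1 hT3.2 hT1.2 (Ne.symm h13)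
  obtain ⟨c₂, hc₂⟩ := collinear_triples_inter_eq_singleton hs hline hZ h5 hT3.1 hT2.1 hT3.2 hT2.2 (Ne.symm h23)
  have hT3sub : T₃ ⊆ (T₃ ∩ T₁) ∪ (T₃ ∩ T₂) := by
    intro x hx
    have hxZ : x ∈ T₁ ∪ T₂ := hTZ ▸ (Finset.mem_powersetCard.1 hT3.1).1 hx
    rw [Finset.mem_union] at hxZ ⊢
    rw [Finset.mem_inter, Finset.mem_inter]
    rcases hxZ with h | h
    · exact Or.inl ⟨hx, h⟩
    · exact Or.inr ⟨hx, h⟩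
  have := Finset.card_le_card hT3sub
  rw [hc₁, hc₂, (Finset.mem_powersetCard.1 hT3.1).2] at this
  have := this.trans (Finset.card_union_le _ _)
  simp at this

end PercRepro.Night4
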